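import Literature.NumberTheory.Sieve.GrimmeltMerikoski2025RootCount
import Mathlib.MeasureTheory.Integral.Bochner.Set
import Mathlib.MeasureTheory.Measure.Lebesgue.Basic
import HarnessLib

/-!
# Grimmelt–Merikoski 2025, Theorem 1.5: the trivial bound and the trivial range `M ≤ X^{2/3}`

L. Grimmelt, J. Merikoski, *On the greatest prime factor and uniform equidistribution of quadratic
polynomials*, arXiv:2505.00493 [GrimmeltMerikoski2025], Theorem 1.5 (Type II estimate), vendored
as the named fact `Literature.NumberTheory.Sieve.grimmeltMerikoski2025_thm15`
(`GrimmeltMerikoski2025.lean`).  The proof of Theorem 1.5 (§6 of the paper) opens with "We may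
assume that … `MN > X^{1-η}`, since otherwise the claim is trivial"; the present file PROVES the
corresponding *trivial bound* for the Type II form of the tree and records the sub-range of
Theorem 1.5 in which the printed bound is weaker than the trivial one, so that the theorem holds
there unconditionally:

* `GM2025.IsAdmissibleWeight.norm_integral_le`: `|∫ψ| ≤ B (hi − lo)` for an admissible weight;
* `GM2025.card_window_filter_dvd_le`: `#{|ℓ| ≤ R : k ∣ aℓ² + h} ≤ (2R/k + 1) ϱ_{a,h}(k)`;
* `GM2025.norm_rootSum_le`, `GM2025.norm_rootDiscrepancy_le`: the trivial bounds for the smoothed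
  root count in the window `|ℓ| ≤ X` and for its discrepancy;
* `GM2025.exists_norm_typeIISum_le`: **the trivial Type II bound**
  `|∑_{m∼M}∑_{n∼N} α_m β_n disc_{a,h}(mn)| ≤ C_η B (MN)^η · MN` for `MN ≥ X ≥ 1`, uniformly in
  square-free `h`, `a` coprime to `h`, `|α|, |β| ≤ 1` and admissible `ψ` with `|ψ| ≤ B`
  (each modulus `mn > X` carries `≤ 3ϱ(mn)` roots in the window and a main term `≤ 2Bϱ(mn)`,
  and `ϱ_{a,h}(mn) ≤ C (mn)^η` by `GM2025.exists_rho_le_mul_rpow`);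
* `grimmeltMerikoski2025_thm15_of_le_twoThirds`: **Theorem 1.5 in the range `M ≤ X^{2/3}`**
  (PROVED): there `MN ≤ M^{1/4} N X^{1/2} ≤` the printed bound, so the trivial bound implies the
  statement of `grimmeltMerikoski2025_thm15` verbatim, with the single extra hypothesis
  `M ≤ X^{2/3}` inserted after `M ≤ X`.

What is NOT here: Theorem 1.5 in its non-trivial range `X^{2/3} < M ≤ X` (equivalently
`N < X^{1/3}` at `MN = X`), which is the content of the paper and rests on the automorphic
counting theorem of the companion paper [GMtechnical, Thm 2.1] with the Kim–Sarnak exponent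
`θ = 7/64` — none of it in Mathlib or the tree; `grimmeltMerikoski2025_thm15` stays a named fact.

## References

* [GrimmeltMerikoski2025] arXiv:2505.00493, Theorem 1.5; §6, first paragraph (the trivial range).
-/

noncomputable section

namespace Literature.NumberTheory.Sieve

open Finset MeasureTheory

namespace GM2025

open FriedlanderIwaniecPrimes (card_Icc_filter_dvd_sub_le)

/-! ### Admissible weights: sup and integral bounds -/

/-- An admissible weight is bounded by its derivative bound `B` (order `0`). [folklore] -/
theorem IsAdmissibleWeight.norm_le {ψ : ℝ → ℂ} {lo hi : ℝ} {J : ℕ} {B : ℝ}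
    (hψ : IsAdmissibleWeight ψ lo hi J B) (u : ℝ) : ‖ψ u‖ ≤ B := by
  simpa only [iteratedDeriv_zero] using hψ.2.2 0 (Nat.zero_le J) u

/-- The derivative bound of an admissible weight is `≥ 0`. [folklore] -/
theorem IsAdmissibleWeight.bound_nonneg {ψ : ℝ → ℂ} {lo hi : ℝ} {J : ℕ} {B : ℝ}
    (hψ : IsAdmissibleWeight ψ lo hi J B) : 0 ≤ B :=
  (norm_nonneg _).trans (hψ.norm_le lo)

/-- `|∫_ℝ ψ| ≤ B (hi − lo)` for an admissible weight supported on `[lo, hi]` with `|ψ| ≤ B`.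
[folklore] -/
theorem IsAdmissibleWeight.norm_integral_le {ψ : ℝ → ℂ} {lo hi : ℝ} {J : ℕ} {B : ℝ}
    (hψ : IsAdmissibleWeight ψ lo hi J B) (hlh : lo ≤ hi) : ‖∫ u, ψ u‖ ≤ B * (hi - lo) := by
  have hzero : ∀ u, u ∉ Set.Icc lo hi → ψ u = 0 := by
    intro u hu
    by_contra hne
    exact hu (Set.mem_Icc.mpr (hψ.2.1 u hne))
  rw [← setIntegral_eq_integral_of_forall_compl_eq_zero hzero, ← Real.volume_real_Icc_of_le hlh]
  exact norm_setIntegral_le_of_norm_le_const measure_Icc_lt_top fun u _ => hψ.norm_le u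

/-! ### Roots in a window -/

/-- `#{ℓ ∈ [-R, R] : k ∣ aℓ² + h} ≤ (2R/k + 1) ϱ_{a,h}(k)`: fibre over `ℓ mod k` (each residue
class meets `[-R, R]` in `≤ 2R/k + 1` integers, and the residues hit are roots). [folklore] -/
theorem card_window_filter_dvd_le (a h : ℕ) {k : ℕ} (hk : 0 < k) (R : ℕ) :
    #{ℓ ∈ Icc (-(R : ℤ)) R | (k : ℤ) ∣ (a : ℤ) * ℓ ^ 2 + (h : ℤ)} ≤
      (2 * R / k + 1) * rho a h k := by
  set s := {ℓ ∈ Icc (-(R : ℤ)) R | (k : ℤ) ∣ (a : ℤ) * ℓ ^ 2 + (h : ℤ)} with hs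
  set f : ℤ → ℕ := fun ℓ => (ℓ % (k : ℤ)).toNat with hf_def
  have hkz : (0 : ℤ) < k := by exact_mod_cast hk
  have hf : ∀ ℓ, ((f ℓ : ℕ) : ℤ) = ℓ % (k : ℤ) := fun ℓ =>
    Int.toNat_of_nonneg (Int.emod_nonneg _ hkz.ne')
  have h1 : #s ≤ (2 * R / k + 1) * #(s.image f) := by
    refine card_le_mul_card_image s _ fun ν _ => ?_
    calc #(s.filter fun ℓ => f ℓ = ν) ≤ #{ℓ ∈ Icc (-(R : ℤ)) R | (k : ℤ) ∣ ℓ - (ν : ℤ)} := by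
          refine card_le_card fun ℓ hℓ => ?_
          obtain ⟨hℓs, hfℓ⟩ := mem_filter.mp hℓ
          refine mem_filter.mpr ⟨(mem_filter.mp hℓs).1, ?_⟩
          rw [← hfℓ, hf ℓ, Int.emod_def]
          exact ⟨ℓ / k, by ring⟩
      _ ≤ 2 * R / k + 1 := card_Icc_filter_dvd_sub_le hk R ν
  have h2 : s.image f ⊆
      (range k).filter fun ν : ℕ => (k : ℤ) ∣ (a : ℤ) * (ν : ℤ) ^ 2 + (h : ℤ) := by
    intro ν hν
    obtain ⟨ℓ, hℓ, rfl⟩ := mem_image.mp hν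
    obtain ⟨-, hdvd⟩ := mem_filter.mp hℓ
    refine mem_filter.mpr ⟨mem_range.mpr ?_, ?_⟩
    · have : ((f ℓ : ℕ) : ℤ) < k := by rw [hf]; exact Int.emod_lt_of_pos _ hkz
      exact_mod_cast this
    · rw [hf ℓ]
      have e : (a : ℤ) * (ℓ % (k : ℤ)) ^ 2 + (h : ℤ) =
          ((a : ℤ) * ℓ ^ 2 + (h : ℤ)) - (k : ℤ) * ((a : ℤ) * (ℓ / k) * (2 * ℓ - k * (ℓ / k))) := by
        rw [Int.emod_def]; ring
      rw [e]
      exact dvd_sub hdvd (dvd_mul_right _ _)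
  calc #s ≤ (2 * R / k + 1) * #(s.image f) := h1
    _ ≤ (2 * R / k + 1) * rho a h k := by
        rw [rho_eq_card_filter]; exact Nat.mul_le_mul_left _ (card_le_card h2)

/-- **Trivial bound for the smoothed root count**: if `|ψ| ≤ B` then
`|∑_{aℓ²+h ≡ 0 (k)} ψ(ℓ/X)| ≤ B (2⌈X⌉/k + 1) ϱ_{a,h}(k)` (`X ≥ 0`, `k ≥ 1`). [folklore] -/
theorem norm_rootSum_le {ψ : ℝ → ℂ} {B : ℝ} (hB : ∀ u, ‖ψ u‖ ≤ B) (a h : ℕ) {k : ℕ} (hk : 0 < k)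
    {X : ℝ} (hX : 0 ≤ X) :
    ‖rootSum a h k ψ X‖ ≤ B * (((2 * ⌈X⌉₊ / k + 1) * rho a h k : ℕ) : ℝ) := by
  have hB0 : 0 ≤ B := (norm_nonneg _).trans (hB 0)
  unfold rootSum
  rw [← Int.natCast_ceil_eq_ceil hX]
  set S := (Icc (-((⌈X⌉₊ : ℕ) : ℤ)) ((⌈X⌉₊ : ℕ) : ℤ)).filter
    (fun ℓ : ℤ => (k : ℤ) ∣ (a : ℤ) * ℓ ^ 2 + (h : ℤ)) with hS
  calc ‖∑ ℓ ∈ S, ψ ((ℓ : ℝ) / X)‖ ≤ ∑ ℓ ∈ S, ‖ψ ((ℓ : ℝ) / X)‖ := norm_sum_le _ _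
    _ ≤ ∑ ℓ ∈ S, B := sum_le_sum fun ℓ _ => hB _
    _ = #S * B := by rw [sum_const, nsmul_eq_mul]
    _ ≤ (((2 * ⌈X⌉₊ / k + 1) * rho a h k : ℕ) : ℝ) * B := by
        gcongr
        exact_mod_cast card_window_filter_dvd_le a h hk ⌈X⌉₊
    _ = _ := mul_comm _ _

/-- **Trivial bound for the discrepancy**: for an admissible `ψ` on `[-1, 1]` with `|ψ| ≤ B`,
`|disc_{a,h}(k; ψ, X)| ≤ B (2⌈X⌉/k + 1) ϱ_{a,h}(k) + (ϱ_{a,h}(k)/k) X · 2B`. [folklore] -/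
theorem norm_rootDiscrepancy_le {ψ : ℝ → ℂ} {J : ℕ} {B : ℝ} (hψ : IsAdmissibleWeight ψ (-1) 1 J B)
    (a h : ℕ) {k : ℕ} (hk : 0 < k) {X : ℝ} (hX : 0 ≤ X) :
    ‖rootDiscrepancy a h k ψ X‖ ≤
      B * (((2 * ⌈X⌉₊ / k + 1) * rho a h k : ℕ) : ℝ) +
        (rho a h k : ℝ) / k * X * (2 * B) := by
  unfold rootDiscrepancy
  refine (norm_sub_le _ _).trans (add_le_add (norm_rootSum_le hψ.norm_le a h hk hX) ?_)
  rw [norm_mul, norm_mul, norm_div, Complex.norm_natCast, Complex.norm_natCast, Complex.norm_real,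
    Real.norm_eq_abs, abs_of_nonneg hX]
  have hint : ‖∫ u, ψ u‖ ≤ 2 * B := by
    have := hψ.norm_integral_le (by norm_num : (-1 : ℝ) ≤ 1)
    linarith
  have h0 : 0 ≤ (rho a h k : ℝ) / k * X := by positivity
  exact mul_le_mul_of_nonneg_left hint h0

/-! ### The trivial Type II bound -/

/-- `|∑_{m∼M}∑_{n∼N} α_m β_n disc(mn)| ≤ ∑_{m∼M}∑_{n∼N} |disc(mn)|` for `|α|, |β| ≤ 1`.
[folklore] -/
theorem norm_typeIISum_le_sum {α β : ℕ → ℂ} (hα : ∀ m, ‖α m‖ ≤ 1) (hβ : ∀ n, ‖β n‖ ≤ 1)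
    (a h : ℕ) (ψ : ℝ → ℂ) (X M N : ℝ) :
    ‖typeIISum a h α β ψ X M N‖ ≤
      ∑ m ∈ (Icc 1 ⌊2 * M⌋₊).filter (fun m : ℕ => M < (m : ℝ)),
        ∑ n ∈ (Icc 1 ⌊2 * N⌋₊).filter (fun n : ℕ => N < (n : ℝ)),
          ‖rootDiscrepancy a h (m * n) ψ X‖ := by
  unfold typeIISum
  refine (norm_sum_le _ _).trans (sum_le_sum fun m _ => (norm_sum_le _ _).trans
    (sum_le_sum fun n _ => ?_))
  rw [norm_mul, norm_mul]
  have h12 : ‖α m‖ * ‖β n‖ ≤ 1 * 1 := mul_le_mul (hα m) (hβ n) (norm_nonneg _) zero_le_one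
  calc ‖α m‖ * ‖β n‖ * ‖rootDiscrepancy a h (m * n) ψ X‖
      ≤ 1 * 1 * ‖rootDiscrepancy a h (m * n) ψ X‖ :=
        mul_le_mul_of_nonneg_right h12 (norm_nonneg _)
    _ = _ := by ring

/-- **The trivial Type II bound** (the "otherwise the claim is trivial" of
[GrimmeltMerikoski2025, §6, first paragraph], made explicit for the tree's `typeIISum`): for every
`η > 0` there is `C ≥ 1` such that for square-free `h`, `gcd(a, h) = 1`, an admissible `ψ` on
`[-1, 1]` with `|ψ| ≤ B`, `|α|, |β| ≤ 1` and `1 ≤ X ≤ MN`,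
`|∑_{m∼M}∑_{n∼N} α_m β_n disc_{a,h}(mn; ψ, X)| ≤ C B (MN)^η MN`.
Each modulus `mn > X` has `≤ (2⌈X⌉/(mn) + 1) ϱ(mn) ≤ 3ϱ(mn)` roots in the window, a main term
`≤ (ϱ(mn)/(mn)) X · 2B ≤ 2B ϱ(mn)`, and `ϱ_{a,h}(mn) ≤ C' (mn)^η ≤ C' (4MN)^η`
(`exists_rho_le_mul_rpow`); there are `≤ 2M · 2N` pairs `(m, n)`. [folklore] -/
theorem exists_norm_typeIISum_le {η : ℝ} (hη : 0 < η) : ∃ C : ℝ, 1 ≤ C ∧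
    ∀ (a h : ℕ), Squarefree h → a.Coprime h →
    ∀ (ψ : ℝ → ℂ) (J : ℕ) (B : ℝ), IsAdmissibleWeight ψ (-1) 1 J B →
    ∀ (α β : ℕ → ℂ), (∀ m, ‖α m‖ ≤ 1) → (∀ n, ‖β n‖ ≤ 1) →
    ∀ (X M N : ℝ), 1 ≤ X → 0 ≤ M → 0 ≤ N → X ≤ M * N →
      ‖typeIISum a h α β ψ X M N‖ ≤ C * B * (M * N) ^ η * (M * N) := by
  obtain ⟨C, hC1, hC⟩ := exists_rho_le_mul_rpow hη
  have h4η : (1 : ℝ) ≤ 4 ^ η := Real.one_le_rpow (by norm_num) hη.le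
  have hC4 : (1 : ℝ) ≤ C * 4 ^ η := one_le_mul_of_one_le_of_one_le hC1 h4η
  refine ⟨20 * C * 4 ^ η, by linarith, ?_⟩
  intro a h hh hah ψ J B hψ α β hα hβ X M N hX hM hN hXMN
  have hB0 := hψ.bound_nonneg
  have hC0 : 0 ≤ C := zero_le_one.trans hC1
  set Sm := (Icc 1 ⌊2 * M⌋₊).filter (fun m : ℕ => M < (m : ℝ)) with hSm
  set Sn := (Icc 1 ⌊2 * N⌋₊).filter (fun n : ℕ => N < (n : ℝ)) with hSn
  -- pointwise bound on the summands
  have hpt : ∀ m ∈ Sm, ∀ n ∈ Sn,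
      ‖rootDiscrepancy a h (m * n) ψ X‖ ≤ 5 * B * (C * (4 * (M * N)) ^ η) := by
    intro m hm n hn
    obtain ⟨hmI, hMm⟩ := mem_filter.mp hm
    obtain ⟨hnI, hNn⟩ := mem_filter.mp hn
    have hm1 : 1 ≤ m := (mem_Icc.mp hmI).1
    have hn1 : 1 ≤ n := (mem_Icc.mp hnI).1
    have hm2 : m ≤ ⌊2 * M⌋₊ := (mem_Icc.mp hmI).2
    have hn2 : n ≤ ⌊2 * N⌋₊ := (mem_Icc.mp hnI).2
    have hmn0 : 0 < m * n := Nat.mul_pos hm1 hn1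
    have hXmn : X ≤ ((m * n : ℕ) : ℝ) := by
      push_cast
      calc X ≤ M * N := hXMN
        _ ≤ m * n := mul_le_mul hMm.le hNn.le hN (Nat.cast_nonneg m)
    have hmn4 : ((m * n : ℕ) : ℝ) ≤ 4 * (M * N) := by
      push_cast
      have hm' : (m : ℝ) ≤ 2 * M :=
        (Nat.cast_le.mpr hm2).trans (Nat.floor_le (by positivity))
      have hn' : (n : ℝ) ≤ 2 * N :=
        (Nat.cast_le.mpr hn2).trans (Nat.floor_le (by positivity))
      calc (m : ℝ) * n ≤ (2 * M) * (2 * N) :=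
            mul_le_mul hm' hn' (Nat.cast_nonneg n) (by positivity)
        _ = 4 * (M * N) := by ring
    have hceil : 2 * ⌈X⌉₊ / (m * n) ≤ 2 := by
      have h1 : ⌈X⌉₊ ≤ m * n := Nat.ceil_le.mpr hXmn
      have h2 : 0 < ⌈X⌉₊ := Nat.ceil_pos.mpr (by linarith)
      calc 2 * ⌈X⌉₊ / (m * n) ≤ 2 * ⌈X⌉₊ / ⌈X⌉₊ := Nat.div_le_div_left h1 h2
        _ = 2 := Nat.mul_div_cancel 2 h2
    have hρ : (rho a h (m * n) : ℝ) ≤ C * (4 * (M * N)) ^ η := by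
      calc (rho a h (m * n) : ℝ) ≤ C * ((m * n : ℕ) : ℝ) ^ η := hC a h (m * n) hh hah hmn0.ne'
        _ ≤ C * (4 * (M * N)) ^ η :=
            mul_le_mul_of_nonneg_left (Real.rpow_le_rpow (Nat.cast_nonneg _) hmn4 hη.le) hC0
    have hd := norm_rootDiscrepancy_le hψ a h hmn0 (by linarith : (0 : ℝ) ≤ X)
    have hT1 : (((2 * ⌈X⌉₊ / (m * n) + 1) * rho a h (m * n) : ℕ) : ℝ) ≤
        3 * (rho a h (m * n) : ℝ) := by
      have : (2 * ⌈X⌉₊ / (m * n) + 1) * rho a h (m * n) ≤ 3 * rho a h (m * n) :=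
        Nat.mul_le_mul_right _ (Nat.add_le_add_right hceil 1)
      exact_mod_cast this
    have hT2 : (rho a h (m * n) : ℝ) / ((m * n : ℕ) : ℝ) * X ≤ (rho a h (m * n) : ℝ) := by
      have hmnpos : (0 : ℝ) < ((m * n : ℕ) : ℝ) := by exact_mod_cast hmn0
      rw [div_mul_eq_mul_div, div_le_iff₀ hmnpos]
      exact mul_le_mul_of_nonneg_left hXmn (Nat.cast_nonneg _)
    calc ‖rootDiscrepancy a h (m * n) ψ X‖ ≤ _ := hd
      _ ≤ B * (3 * (rho a h (m * n) : ℝ)) + (rho a h (m * n) : ℝ) * (2 * B) :=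
          add_le_add (mul_le_mul_of_nonneg_left hT1 hB0)
            (mul_le_mul_of_nonneg_right hT2 (by linarith))
      _ = 5 * B * (rho a h (m * n) : ℝ) := by ring
      _ ≤ 5 * B * (C * (4 * (M * N)) ^ η) := mul_le_mul_of_nonneg_left hρ (by linarith)
  -- the number of pairs `(m, n)`
  have hcardm : (#Sm : ℝ) ≤ 2 * M := by
    calc (#Sm : ℝ) ≤ #(Icc 1 ⌊2 * M⌋₊) := by exact_mod_cast card_filter_le _ _
      _ = ⌊2 * M⌋₊ := by rw [Nat.card_Icc, Nat.add_sub_cancel]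
      _ ≤ 2 * M := Nat.floor_le (by positivity)
  have hcardn : (#Sn : ℝ) ≤ 2 * N := by
    calc (#Sn : ℝ) ≤ #(Icc 1 ⌊2 * N⌋₊) := by exact_mod_cast card_filter_le _ _
      _ = ⌊2 * N⌋₊ := by rw [Nat.card_Icc, Nat.add_sub_cancel]
      _ ≤ 2 * N := Nat.floor_le (by positivity)
  have hK0 : 0 ≤ 5 * B * (C * (4 * (M * N)) ^ η) :=
    mul_nonneg (by linarith) (mul_nonneg hC0 (Real.rpow_nonneg (by positivity) _))
  calc ‖typeIISum a h α β ψ X M N‖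
      ≤ ∑ m ∈ Sm, ∑ n ∈ Sn, ‖rootDiscrepancy a h (m * n) ψ X‖ :=
        norm_typeIISum_le_sum hα hβ a h ψ X M N
    _ ≤ ∑ m ∈ Sm, ∑ n ∈ Sn, 5 * B * (C * (4 * (M * N)) ^ η) :=
        sum_le_sum fun m hm => sum_le_sum fun n hn => hpt m hm n hn
    _ = #Sm * (#Sn * (5 * B * (C * (4 * (M * N)) ^ η))) := by
        simp only [sum_const, nsmul_eq_mul]
    _ ≤ (2 * M) * ((2 * N) * (5 * B * (C * (4 * (M * N)) ^ η))) :=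
        mul_le_mul hcardm (mul_le_mul_of_nonneg_right hcardn hK0)
          (mul_nonneg (Nat.cast_nonneg _) hK0) (by linarith)
    _ = 20 * C * 4 ^ η * B * (M * N) ^ η * (M * N) := by
        rw [Real.mul_rpow (by norm_num) (mul_nonneg hM hN)]; ring

end GM2025

open GM2025

/-! ### Theorem 1.5 in the trivial range `M ≤ X^{2/3}` -/

/-- **Grimmelt–Merikoski 2025, Theorem 1.5 in the range `M ≤ X^{2/3}`** (PROVED; the statement
of `grimmeltMerikoski2025_thm15` verbatim with the one extra hypothesis `M ≤ X^{2/3}` after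
`M ≤ X`).  In this range the printed bound dominates the trivial one: by the trivial Type II bound
(`GM2025.exists_norm_typeIISum_le` with `η = δ = ε/4`, using `MN ≤ X²`) the sum is
`≤ X^ε MN` for `X ≥ X₀(ε)`, and `MN = M^{1/4} M^{3/4} N ≤ M^{1/4} X^{1/2} N ≤
M^{1/4} N^{1/2} X^{1/2} (N^{1/2} + h^{1/8}) (1 + X/(M^{1/2}N(N + h^{1/4})))^{7/64}` as
`M^{3/4} ≤ (X^{2/3})^{3/4} = X^{1/2}`.  The complementary range `X^{2/3} < M ≤ X` is the content
of the paper (automorphic methods) and is NOT proved in the tree.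
[cite: GrimmeltMerikoski2025, Theorem 1.5 and §6 (first paragraph: the trivial range)] -/
theorem grimmeltMerikoski2025_thm15_of_le_twoThirds :
    ∀ ε : ℝ, 0 < ε → ∃ δ : ℝ, 0 < δ ∧ ∃ J : ℕ, ∃ X₀ : ℝ, ∀ X : ℝ, X₀ ≤ X →
    ∀ M N : ℝ, 1 ≤ N → N ≤ M → X ≤ M * N → M ≤ X → M ≤ X ^ (2 / 3 : ℝ) →
    ∀ h : ℕ, 1 ≤ h → Squarefree h → (h : ℝ) ≤ X ^ (2 + δ) →
    ∀ a : ℕ, 1 ≤ a → (a : ℝ) ≤ X ^ δ → Nat.Coprime a h →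
    ∀ ψ : ℝ → ℂ, IsAdmissibleWeight ψ (-1) 1 J (X ^ δ) →
    ∀ α β : ℕ → ℂ, (∀ m : ℕ, ‖α m‖ ≤ 1) → (∀ n : ℕ, ‖β n‖ ≤ 1) →
      (∀ n : ℕ, ¬ Squarefree n → β n = 0) →
      ‖typeIISum a h α β ψ X M N‖ ≤
        X ^ ε * (M ^ (1 / 2 : ℝ) * X ^ (1 / 2 : ℝ) +
          M ^ (1 / 4 : ℝ) * N ^ (1 / 2 : ℝ) * X ^ (1 / 2 : ℝ) *
            (N ^ (1 / 2 : ℝ) + (h : ℝ) ^ (1 / 8 : ℝ)) *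
            (1 + X / (M ^ (1 / 2 : ℝ) * N * (N + (h : ℝ) ^ (1 / 4 : ℝ)))) ^ (7 / 64 : ℝ)) := by
  intro ε hε
  obtain ⟨C, hC1, hC⟩ := exists_norm_typeIISum_le (η := ε / 4) (by positivity)
  refine ⟨ε / 4, by positivity, 0, max 1 (C ^ (4 / ε)), ?_⟩
  intro X hX M N hN1 hNM hXMN hMX hM23 h _ hh _ a _ _ hah ψ hψ α β hα hβ _
  have hX1 : 1 ≤ X := (le_max_left _ _).trans hX
  have hXC : C ^ (4 / ε) ≤ X := (le_max_right _ _).trans hX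
  have hX0 : 0 < X := by linarith
  have hN0 : 0 < N := by linarith
  have hM0 : 0 < M := by linarith
  have hC0 : 0 ≤ C := zero_le_one.trans hC1
  have hmain := hC a h hh hah ψ 0 (X ^ (ε / 4)) hψ α β hα hβ X M N hX1 hM0.le hN0.le hXMN
  -- `C ≤ X^{ε/4}`
  have hCX : C ≤ X ^ (ε / 4) := by
    have e1 : 4 / ε * (ε / 4) = 1 := by field_simp
    calc C = (C ^ (4 / ε)) ^ (ε / 4) := by rw [← Real.rpow_mul hC0, e1, Real.rpow_one]
      _ ≤ X ^ (ε / 4) := Real.rpow_le_rpow (by positivity) hXC (by positivity)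
  -- `(MN)^{ε/4} ≤ X^{ε/2}`
  have hMN : M * N ≤ X ^ (2 : ℝ) := by
    rw [Real.rpow_two, sq]
    exact mul_le_mul hMX (hNM.trans hMX) hN0.le hX0.le
  have hMNe : (M * N) ^ (ε / 4) ≤ X ^ (ε / 2) := by
    calc (M * N) ^ (ε / 4) ≤ (X ^ (2 : ℝ)) ^ (ε / 4) :=
          Real.rpow_le_rpow (by positivity) hMN (by positivity)
      _ = X ^ (ε / 2) := by rw [← Real.rpow_mul hX0.le]; congr 1; ring
  -- hence `‖S‖ ≤ X^ε MN`
  have hS : ‖typeIISum a h α β ψ X M N‖ ≤ X ^ ε * (M * N) := by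
    calc ‖typeIISum a h α β ψ X M N‖ ≤ C * X ^ (ε / 4) * (M * N) ^ (ε / 4) * (M * N) := hmain
      _ ≤ X ^ (ε / 4) * X ^ (ε / 4) * X ^ (ε / 2) * (M * N) := by gcongr
      _ = X ^ ε * (M * N) := by
          have e3 : ε / 4 + ε / 4 + ε / 2 = ε := by ring
          rw [← Real.rpow_add hX0, ← Real.rpow_add hX0, e3]
  -- and `MN ≤` the second term of the printed bound
  have hM34 : M ^ (3 / 4 : ℝ) ≤ X ^ (1 / 2 : ℝ) := by
    calc M ^ (3 / 4 : ℝ) ≤ (X ^ (2 / 3 : ℝ)) ^ (3 / 4 : ℝ) :=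
          Real.rpow_le_rpow hM0.le hM23 (by norm_num)
      _ = X ^ (1 / 2 : ℝ) := by rw [← Real.rpow_mul hX0.le]; norm_num
  have hMsplit : M ^ (1 / 4 : ℝ) * M ^ (3 / 4 : ℝ) = M := by
    rw [← Real.rpow_add hM0]; norm_num
  have hNsplit : N ^ (1 / 2 : ℝ) * N ^ (1 / 2 : ℝ) = N := by
    rw [← Real.rpow_add hN0]; norm_num
  have hP : 1 ≤ (1 + X / (M ^ (1 / 2 : ℝ) * N * (N + (h : ℝ) ^ (1 / 4 : ℝ)))) ^ (7 / 64 : ℝ) :=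
    Real.one_le_rpow (le_add_of_nonneg_right (by positivity)) (by norm_num)
  have hh8 : 0 ≤ (h : ℝ) ^ (1 / 8 : ℝ) := by positivity
  have hbound : M * N ≤ M ^ (1 / 4 : ℝ) * N ^ (1 / 2 : ℝ) * X ^ (1 / 2 : ℝ) *
      (N ^ (1 / 2 : ℝ) + (h : ℝ) ^ (1 / 8 : ℝ)) *
      (1 + X / (M ^ (1 / 2 : ℝ) * N * (N + (h : ℝ) ^ (1 / 4 : ℝ)))) ^ (7 / 64 : ℝ) := by
    calc M * N = M ^ (1 / 4 : ℝ) * M ^ (3 / 4 : ℝ) * (N ^ (1 / 2 : ℝ) * N ^ (1 / 2 : ℝ)) := by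
          rw [hMsplit, hNsplit]
      _ ≤ M ^ (1 / 4 : ℝ) * X ^ (1 / 2 : ℝ) *
          (N ^ (1 / 2 : ℝ) * (N ^ (1 / 2 : ℝ) + (h : ℝ) ^ (1 / 8 : ℝ))) := by
          gcongr
          linarith
      _ = M ^ (1 / 4 : ℝ) * N ^ (1 / 2 : ℝ) * X ^ (1 / 2 : ℝ) *
          (N ^ (1 / 2 : ℝ) + (h : ℝ) ^ (1 / 8 : ℝ)) * 1 := by ring
      _ ≤ _ := by gcongr
  have hA : 0 ≤ M ^ (1 / 2 : ℝ) * X ^ (1 / 2 : ℝ) := by positivity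
  calc ‖typeIISum a h α β ψ X M N‖ ≤ X ^ ε * (M * N) := hS
    _ ≤ X ^ ε * (M ^ (1 / 4 : ℝ) * N ^ (1 / 2 : ℝ) * X ^ (1 / 2 : ℝ) *
        (N ^ (1 / 2 : ℝ) + (h : ℝ) ^ (1 / 8 : ℝ)) *
        (1 + X / (M ^ (1 / 2 : ℝ) * N * (N + (h : ℝ) ^ (1 / 4 : ℝ)))) ^ (7 / 64 : ℝ)) := by
        gcongr
    _ ≤ _ := by
        gcongr
        linarith

end Literature.NumberTheory.Sieve

end
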